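/-
Copyright (c) 2026 the pub-hodgecm-mathlib formalisation cell (harness21).  Prover seat hodgecm-mathlib-K2E1-p11 (g3), Track B ∕ K2-LIT, h413 = `stmt-HodgeConjecture-24833`,
R90-TF section S8 «ContSpec-n½», #2 road (G side), S8 dealer R90-CS-plan (g2) S8-R82 (2) «S8 CURRENCY RULING (N = 3 G-side): the (E)-road exhaustion index is (LEVEL `Kf`, `K_∞`-TYPE)» +
DEAL `R90S8ResGKTypeBlockU3Defs` (census `R90/S8/CENSUS-KTypeBlock.K2E1-p11-g3.md` item (2)): the K-TYPE blocks ∕ atoms ∕ lines of record on Mok's carrier `quasiSplit L⁺ L c 3` = the ★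
G-DEFS data at the FINITE level `ι_f(Kf)`, `ω := 1`, CUT by a `K_∞`-isotypic submodule `Iso` of `L²` (a parameter).
-/
import Summits.HodgeConjecture.HodgeConjecture.Theorems.R90S8ResGBlockDataU3Defs    -- ★ p862621 (K2E1-p11): `resGBlock K' ω χ₁ χ₂`, `resGAtom∕resGAtomTop∕resGAtomMid U …`, `resGLine U …` + read-backs
import Literature.NumberTheory.Automorphic.UnitaryGroupRestrictedProduct            -- ★ `finAdelic`, `finAdelicToAdelic : finAdelic →* G(𝔸)` (the finite-level embedding `ι_f`)
import HarnessLib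

/-!
# S8 #2 road (G side) — `R90S8ResGKTypeBlockU3Defs`: THE K-TYPE BLOCK DATA OF RECORD `Sc_τ ∕ At_τ ∕ Ln_τ` ON `U_{L/L⁺}(3) = quasiSplit L⁺ L c 3` — the ★ G-DEFS blocks at the FINITE
# level `K′ := ι_f(Kf)`, `ω := 1` (they carry EVERY `K_∞`-type), CUT by a `K_∞`-isotypic submodule `Iso ≤ L²` (S8-R82 currency: exhaustion index = (level `Kf`, `K_∞`-type))

Track B ∕ K2-LIT, crux h413 = `stmt-HodgeConjecture-24833`, route of record `HCCMUnconditional`; cell `hodgecm-mathlib`, R90-TF programme, section S8 «ContSpec-n½», socket #2's ED. 5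
sub-socket (E) `sock_S8_res_exhaustion_le_closure` (S8-R68) and its letter road (HEAD₃)(E_blk,₃)(O₃)(N₃) at K-TYPE blocks (S8-R82 (2)).  DEFINITIONS FILE (`--kind definition
--supports stmt-HodgeConjecture-24833 --as helper`): three `def`s + `Iff.rfl`∕`inf_le`-deep read-backs; no `instance`, no `notation`, no named-fact hypothesis, no `sorry`.  CLOSES NO
SOCKET; pays no letter; FIXES THE BYTES the K-type letter hands key to.

WHY THE CUT LIVES ON THE `L²` SIDE (census (1)–(3), S8-R82).  A character-typed block `resGBlock K' ω χ₁ χ₂` with `K' ⊇ ι_∞(K_∞)` sees only the one-dimensional `K_∞`-types, and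
exhaustion over those alone is FALSE at N = 3 (`K_∞ ≅ U(2) × U(1)` non-abelian).  At the FINITE level `K' := ι_f(Kf) = Kf.map finAdelicToAdelic` with `ω := 1` the sections carry NO
`K_∞`-condition, so ★ `resGBlock L μ (ι_f Kf) 1 χ₁ χ₂` contains the wave packets of EVERY `K_∞`-type; the `τ`-block is its intersection with the `τ`-isotypic submodule `Iso` of
`L²` — ★ `HilbertRepIsotypicComponent.isotypicComponent` of the `K_∞`-restriction of `R_μ` in the consumer's spelling (K2E1-p14's `Iso (Kf, W) := Fix(ι_f Kf) ⊓ isotypicComponent W`;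
his `Fix` meets these blocks through the XS letter «`resGBlock (ι_f Kf) 1 … ≤ Fix(ι_f Kf)`»).  `Iso` is a PARAMETER here (no coupling of bytes between the two files; no section-level
character projector is needed — ★ `Schur.charProj` is vector-level and `= starProjection (isotypicComponent τ)`, ★ `charProj_eq_starProjection_isotypicComponent`).  The
identification «`τ`-block = closed span of the wave packets of `τ`-isotypic sections = `P_τ (resGBlock (ι_f Kf) 1 …)`» (block closed and `K_∞`-stable ⇒ `P_τ Sc = Sc ⊓ Iso_τ`) is a
LETTER for a later hand, not claimed here [BrockerTomDieck1985 III (5.10); DeitmarEchterhoff2014 Prop. 7.3.3; MoeglinWaldspurger1995 I.2.17, II.2.4].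
* D1 `resGBlockK Iso Kf χ₁ χ₂ := resGBlock L μ (Kf.map ι_f) 1 χ₁ χ₂ ⊓ Iso` (+ `mem_resGBlockK_iff`, `resGBlockK_le_resGBlock`, `resGBlockK_le_iso`, `resGBlockK_mono`, `resGBlockK_top`, `isClosed_resGBlockK`).
* D2 `resGAtomK Iso U Kf χ₁ χ₂ := resGAtom L μ U (Kf.map ι_f) 1 χ₁ χ₂ ⊓ Iso` (+ `mem_…_iff`, `…_le_resGAtom`, `…_le_iso`, `resGAtomK_le_resGBlockK`, `resGAtomK_mono`).
* D3 `resGLineK Iso U Kf χ₁ χ₂ := resGLine L μ U (Kf.map ι_f) 1 χ₁ χ₂ ⊓ Iso` (+ `mem_…_iff`, `…_le_resGLine`, `…_le_iso`, `resGLineK_le_resGBlockK`, `resGLineK_mono`, in-block (O)_K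
  `isOrtho_resGAtomK_resGLineK`, (N-iface)_K `inner_eq_zero_of_mem_resGLineK`).
CONSUMER SHAPE (★ F1_qs at the K-type index `i = (Kf, W)`, `b = (χ₁, χ₂)`): `Iso i := ‹K2E1-p14›`, `Blk i b := resGBlockK L μ (Iso_W) Kf χ₁ χ₂`, `At i b := resGAtomK L μ (Iso_W) (U i b) Kf χ₁ χ₂`,
`Ln i b := resGLineK …`; every K-type twin of a LEVEL letter is then ONE generic Hilbert lemma («an orthogonal projection `Q` with `Q S_b ⊆ S_b` maps `cl ⨆ S_b` into `cl ⨆ (S_b ⊓ range Q)`»)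
plus the blocks' `K_∞`-stability (census (4)).
HONEST LABEL: HC_CM is proved only modulo the 7 printed citations (2 remaining named inputs: hLiu418 = `stmt-HodgeConjecture-24832`, h413 = `stmt-HodgeConjecture-24833`) until
rung 0 closes; REL ≠ ★ ≠ BUILT; definitions pay nothing; count-neutral.

## References
* [MoeglinWaldspurger1995] C. Mœglin, J.-L. Waldspurger, *Spectral Decomposition and Eisenstein Series* (1995), I.2.17–18, II.2.4, V.3.13, VI.2.
* [BrockerTomDieck1985] T. Bröcker, T. tom Dieck, *Representations of Compact Lie Groups* (1985), III (5.7), (5.10).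
* [DeitmarEchterhoff2014] A. Deitmar, S. Echterhoff, *Principles of Harmonic Analysis*, 2nd ed. (2014), §7.3, Prop. 7.3.3.
* [Rogawski1990] J. D. Rogawski, *Automorphic Representations of Unitary Groups in Three Variables* (1990), §13.9 p. 229.
-/

set_option autoImplicit false
set_option linter.dupNamespace false  -- the mandated namespace `…HodgeConjecture.HodgeConjecture.R90.S8` (LEAD #1 L1) repeats the summit's segment

noncomputable section

open MeasureTheory Measure Set Filter Topology NumberField
open Literature.NumberTheory.Automorphic Literature.NumberTheory.Automorphic.UnitaryGroup Literature.NumberTheory.GaloisRepresentations AdelicGroupData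
open Literature.NumberTheory.Automorphic.Arthur2013.Leaves.TECR
open scoped InnerProductSpace

namespace Summit.HodgeConjecture.HodgeConjecture.R90.S8

variable (L : Type) [Field L] [NumberField L] [IsCMField L]
  (μ : Measure (quasiSplit (↥(maximalRealSubfield L)) L (IsCMField.complexConj L) 3).automorphicQuotient)

/-! ## D1 The K-type block `Sc_τ(Kf; χ₁, χ₂) := Sc(ι_f Kf, 1; χ₁, χ₂) ⊓ Iso_τ` -/

/-- **D1 — THE K-TYPE BLOCK OF RECORD**: the ★ `(K′, ω)`-block at the FINITE level `K′ := ι_f(Kf) = Kf.map finAdelicToAdelic`, `ω := 1` (wave packets of ALL `K_∞`-types of the Borel datum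
`(χ₁, χ₂)`), cut by a `K_∞`-isotypic submodule `Iso ≤ L²` (parameter; the consumer's ★ `isotypicComponent`).  Index currency of S8-R82: (level `Kf`, `K_∞`-type).
[cite: MoeglinWaldspurger1995, I.2.17, II.2.4] [cite: DeitmarEchterhoff2014, §7.3] -/
def resGBlockK (Iso : Submodule ℂ ((quasiSplit (↥(maximalRealSubfield L)) L (IsCMField.complexConj L) 3).L2 μ))
    (Kf : Subgroup (finAdelic (↥(maximalRealSubfield L)) L (IsCMField.complexConj L) 3 ((StdForm.antidiagonal 3).over L)))
    (χ₁ : HeckeCharacter L) (χ₂ : ↥(TorusDict.torus (IsCMField.complexConj L)) →ₜ* ℂˣ) :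
    Submodule ℂ ((quasiSplit (↥(maximalRealSubfield L)) L (IsCMField.complexConj L) 3).L2 μ) :=
  resGBlock L μ (Kf.map (finAdelicToAdelic (↥(maximalRealSubfield L)) L (IsCMField.complexConj L) 3 ((StdForm.antidiagonal 3).over L))) 1 χ₁ χ₂ ⊓ Iso

/-! ## D2∕D3 The K-type atoms `At_τ := At(U; ι_f Kf, 1; χ₁, χ₂) ⊓ Iso_τ` and lines `Ln_τ := Ln(U; ι_f Kf, 1; χ₁, χ₂) ⊓ Iso_τ` (regime R1, three-slot model map `U`) -/

variable {A M Λ : Type*} [AddCommGroup A] [Module ℂ A] [AddCommGroup M] [Module ℂ M] [AddCommGroup Λ] [Module ℂ Λ]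

/-- **D2 — THE K-TYPE ATOM PART**: ★ `resGAtom` (block vectors with zero line coordinate in the model map `U : L² →ₗ[ℂ] (A × M) × Λ`) at the finite level `ι_f(Kf)`, `ω := 1`, cut by `Iso`.
[cite: MoeglinWaldspurger1995, V.3.13, VI.2] -/
def resGAtomK (Iso : Submodule ℂ ((quasiSplit (↥(maximalRealSubfield L)) L (IsCMField.complexConj L) 3).L2 μ))
    (U : (quasiSplit (↥(maximalRealSubfield L)) L (IsCMField.complexConj L) 3).L2 μ →ₗ[ℂ] (A × M) × Λ)
    (Kf : Subgroup (finAdelic (↥(maximalRealSubfield L)) L (IsCMField.complexConj L) 3 ((StdForm.antidiagonal 3).over L)))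
    (χ₁ : HeckeCharacter L) (χ₂ : ↥(TorusDict.torus (IsCMField.complexConj L)) →ₜ* ℂˣ) :
    Submodule ℂ ((quasiSplit (↥(maximalRealSubfield L)) L (IsCMField.complexConj L) 3).L2 μ) :=
  resGAtom L μ U (Kf.map (finAdelicToAdelic (↥(maximalRealSubfield L)) L (IsCMField.complexConj L) 3 ((StdForm.antidiagonal 3).over L))) 1 χ₁ χ₂ ⊓ Iso

/-- **D3 — THE K-TYPE LINE PART**: ★ `resGLine` (`Sc ⊓ Atᗮ`, regime R1) at the finite level `ι_f(Kf)`, `ω := 1`, cut by `Iso`. [cite: MoeglinWaldspurger1995, VI.2] -/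
def resGLineK (Iso : Submodule ℂ ((quasiSplit (↥(maximalRealSubfield L)) L (IsCMField.complexConj L) 3).L2 μ))
    (U : (quasiSplit (↥(maximalRealSubfield L)) L (IsCMField.complexConj L) 3).L2 μ →ₗ[ℂ] (A × M) × Λ)
    (Kf : Subgroup (finAdelic (↥(maximalRealSubfield L)) L (IsCMField.complexConj L) 3 ((StdForm.antidiagonal 3).over L)))
    (χ₁ : HeckeCharacter L) (χ₂ : ↥(TorusDict.torus (IsCMField.complexConj L)) →ₜ* ℂˣ) :
    Submodule ℂ ((quasiSplit (↥(maximalRealSubfield L)) L (IsCMField.complexConj L) 3).L2 μ) :=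
  resGLine L μ U (Kf.map (finAdelicToAdelic (↥(maximalRealSubfield L)) L (IsCMField.complexConj L) 3 ((StdForm.antidiagonal 3).over L))) 1 χ₁ χ₂ ⊓ Iso

variable (Iso Iso' : Submodule ℂ ((quasiSplit (↥(maximalRealSubfield L)) L (IsCMField.complexConj L) 3).L2 μ))
  (U : (quasiSplit (↥(maximalRealSubfield L)) L (IsCMField.complexConj L) 3).L2 μ →ₗ[ℂ] (A × M) × Λ)
  (Kf : Subgroup (finAdelic (↥(maximalRealSubfield L)) L (IsCMField.complexConj L) 3 ((StdForm.antidiagonal 3).over L)))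
  (χ₁ : HeckeCharacter L) (χ₂ : ↥(TorusDict.torus (IsCMField.complexConj L)) →ₜ* ℂˣ)

/-! ## Read-backs for D1 -/

/-- Read-back: `v ∈ Sc_τ ↔ v ∈ Sc(ι_f Kf, 1) ∧ v ∈ Iso`. [cite: DeitmarEchterhoff2014, §7.3] -/
theorem mem_resGBlockK_iff (v : (quasiSplit (↥(maximalRealSubfield L)) L (IsCMField.complexConj L) 3).L2 μ) :
    v ∈ resGBlockK L μ Iso Kf χ₁ χ₂ ↔
      v ∈ resGBlock L μ (Kf.map (finAdelicToAdelic (↥(maximalRealSubfield L)) L (IsCMField.complexConj L) 3 ((StdForm.antidiagonal 3).over L))) 1 χ₁ χ₂ ∧ v ∈ Iso :=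
  Iff.rfl

/-- Read-back: `Sc_τ ≤ Sc(ι_f Kf, 1)`. [cite: MoeglinWaldspurger1995, II.2.4] -/
theorem resGBlockK_le_resGBlock :
    resGBlockK L μ Iso Kf χ₁ χ₂ ≤ resGBlock L μ (Kf.map (finAdelicToAdelic (↥(maximalRealSubfield L)) L (IsCMField.complexConj L) 3 ((StdForm.antidiagonal 3).over L))) 1 χ₁ χ₂ :=
  inf_le_left

/-- Read-back: `Sc_τ ≤ Iso` (the K-type block lies in the consumer's isotypic piece). [cite: DeitmarEchterhoff2014, §7.3] -/
theorem resGBlockK_le_iso : resGBlockK L μ Iso Kf χ₁ χ₂ ≤ Iso :=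
  inf_le_right

/-- Read-back: monotone in `Iso`. [folklore] -/
theorem resGBlockK_mono (h : Iso ≤ Iso') : resGBlockK L μ Iso Kf χ₁ χ₂ ≤ resGBlockK L μ Iso' Kf χ₁ χ₂ :=
  inf_le_inf_left _ h

/-- Read-back: with `Iso := ⊤` the K-type block is the whole finite-level block (all `K_∞`-types). [cite: MoeglinWaldspurger1995, II.2.4] -/
theorem resGBlockK_top :
    resGBlockK L μ ⊤ Kf χ₁ χ₂ = resGBlock L μ (Kf.map (finAdelicToAdelic (↥(maximalRealSubfield L)) L (IsCMField.complexConj L) 3 ((StdForm.antidiagonal 3).over L))) 1 χ₁ χ₂ :=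
  inf_top_eq _

/-- Read-back: the K-type block is closed as soon as `Iso` is (e.g. an ★ `isotypicComponent`'s carrier). [cite: DeitmarEchterhoff2014, §7.3] -/
theorem isClosed_resGBlockK (hIso : IsClosed (Iso : Set ((quasiSplit (↥(maximalRealSubfield L)) L (IsCMField.complexConj L) 3).L2 μ))) :
    IsClosed (resGBlockK L μ Iso Kf χ₁ χ₂ : Set ((quasiSplit (↥(maximalRealSubfield L)) L (IsCMField.complexConj L) 3).L2 μ)) :=
  (isClosed_resGBlock L μ _ 1 χ₁ χ₂).inter hIso

/-! ## Read-backs for D2∕D3 -/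

/-- Read-back: `v ∈ At_τ ↔ v ∈ At(U; ι_f Kf, 1) ∧ v ∈ Iso`. [cite: MoeglinWaldspurger1995, VI.2] -/
theorem mem_resGAtomK_iff (v : (quasiSplit (↥(maximalRealSubfield L)) L (IsCMField.complexConj L) 3).L2 μ) :
    v ∈ resGAtomK L μ Iso U Kf χ₁ χ₂ ↔
      v ∈ resGAtom L μ U (Kf.map (finAdelicToAdelic (↥(maximalRealSubfield L)) L (IsCMField.complexConj L) 3 ((StdForm.antidiagonal 3).over L))) 1 χ₁ χ₂ ∧ v ∈ Iso :=
  Iff.rfl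

/-- Read-back: `v ∈ Ln_τ ↔ v ∈ Ln(U; ι_f Kf, 1) ∧ v ∈ Iso`. [cite: MoeglinWaldspurger1995, VI.2] -/
theorem mem_resGLineK_iff (v : (quasiSplit (↥(maximalRealSubfield L)) L (IsCMField.complexConj L) 3).L2 μ) :
    v ∈ resGLineK L μ Iso U Kf χ₁ χ₂ ↔
      v ∈ resGLine L μ U (Kf.map (finAdelicToAdelic (↥(maximalRealSubfield L)) L (IsCMField.complexConj L) 3 ((StdForm.antidiagonal 3).over L))) 1 χ₁ χ₂ ∧ v ∈ Iso :=
  Iff.rfl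

/-- Read-back: `At_τ ≤ At`. [cite: MoeglinWaldspurger1995, VI.2] -/
theorem resGAtomK_le_resGAtom :
    resGAtomK L μ Iso U Kf χ₁ χ₂ ≤ resGAtom L μ U (Kf.map (finAdelicToAdelic (↥(maximalRealSubfield L)) L (IsCMField.complexConj L) 3 ((StdForm.antidiagonal 3).over L))) 1 χ₁ χ₂ :=
  inf_le_left

/-- Read-back: `At_τ ≤ Iso`. [cite: DeitmarEchterhoff2014, §7.3] -/
theorem resGAtomK_le_iso : resGAtomK L μ Iso U Kf χ₁ χ₂ ≤ Iso :=
  inf_le_right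

/-- Read-back: `Ln_τ ≤ Ln`. [cite: MoeglinWaldspurger1995, VI.2] -/
theorem resGLineK_le_resGLine :
    resGLineK L μ Iso U Kf χ₁ χ₂ ≤ resGLine L μ U (Kf.map (finAdelicToAdelic (↥(maximalRealSubfield L)) L (IsCMField.complexConj L) 3 ((StdForm.antidiagonal 3).over L))) 1 χ₁ χ₂ :=
  inf_le_left

/-- Read-back: `Ln_τ ≤ Iso`. [cite: DeitmarEchterhoff2014, §7.3] -/
theorem resGLineK_le_iso : resGLineK L μ Iso U Kf χ₁ χ₂ ≤ Iso :=
  inf_le_right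

/-- Read-back «at_le_sc»_K: `At_τ ≤ Sc_τ`. [cite: MoeglinWaldspurger1995, VI.2] -/
theorem resGAtomK_le_resGBlockK : resGAtomK L μ Iso U Kf χ₁ χ₂ ≤ resGBlockK L μ Iso Kf χ₁ χ₂ :=
  inf_le_inf_right _ (resGAtom_le_resGBlock L μ U _ 1 χ₁ χ₂)

/-- Read-back «ln_le_sc»_K: `Ln_τ ≤ Sc_τ`. [cite: MoeglinWaldspurger1995, VI.2] -/
theorem resGLineK_le_resGBlockK : resGLineK L μ Iso U Kf χ₁ χ₂ ≤ resGBlockK L μ Iso Kf χ₁ χ₂ :=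
  inf_le_inf_right _ (resGLine_le_resGBlock L μ U _ 1 χ₁ χ₂)

/-- Read-back: `At_τ` monotone in `Iso`. [folklore] -/
theorem resGAtomK_mono (h : Iso ≤ Iso') : resGAtomK L μ Iso U Kf χ₁ χ₂ ≤ resGAtomK L μ Iso' U Kf χ₁ χ₂ :=
  inf_le_inf_left _ h

/-- Read-back: `Ln_τ` monotone in `Iso`. [folklore] -/
theorem resGLineK_mono (h : Iso ≤ Iso') : resGLineK L μ Iso U Kf χ₁ χ₂ ≤ resGLineK L μ Iso' U Kf χ₁ χ₂ :=
  inf_le_inf_left _ h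

/-- Read-back (in-block half of letter (O₃) at K-types): `At_τ ⟂ Ln_τ` (★ `isOrtho_resGAtom_resGLine`, monotonicity). [cite: MoeglinWaldspurger1995, VI.2] -/
theorem isOrtho_resGAtomK_resGLineK : resGAtomK L μ Iso U Kf χ₁ χ₂ ⟂ resGLineK L μ Iso U Kf χ₁ χ₂ :=
  (isOrtho_resGAtom_resGLine L μ U _ 1 χ₁ χ₂).mono (resGAtomK_le_resGAtom L μ Iso U Kf χ₁ χ₂) (resGLineK_le_resGLine L μ Iso U Kf χ₁ χ₂)

/-- **Read-back (N-iface)_K — «a vector whose finite-level block component has zero line coordinate is orthogonal to `Ln_τ`»** (★ `inner_eq_zero_of_mem_resGLine` at `v ∈ Ln_τ ≤ Ln`): if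
`v ∈ Ln_τ` and `x = y + (x − y)` with `y ∈ Sc(ι_f Kf, 1)`, `x − y ⟂ Sc(ι_f Kf, 1)`, `(U y).2 = 0`, then `⟪v, x⟫ = 0`. [cite: MoeglinWaldspurger1995, V.3.13, VI.2] -/
theorem inner_eq_zero_of_mem_resGLineK {v : (quasiSplit (↥(maximalRealSubfield L)) L (IsCMField.complexConj L) 3).L2 μ} (hv : v ∈ resGLineK L μ Iso U Kf χ₁ χ₂)
    (x : (quasiSplit (↥(maximalRealSubfield L)) L (IsCMField.complexConj L) 3).L2 μ)
    (hx : ∃ y ∈ resGBlock L μ (Kf.map (finAdelicToAdelic (↥(maximalRealSubfield L)) L (IsCMField.complexConj L) 3 ((StdForm.antidiagonal 3).over L))) 1 χ₁ χ₂,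
      x - y ∈ (resGBlock L μ (Kf.map (finAdelicToAdelic (↥(maximalRealSubfield L)) L (IsCMField.complexConj L) 3 ((StdForm.antidiagonal 3).over L))) 1 χ₁ χ₂)ᗮ ∧ (U y).2 = 0) :
    ⟪v, x⟫_ℂ = 0 :=
  inner_eq_zero_of_mem_resGLine L μ U _ 1 χ₁ χ₂ hv.1 x hx

end Summit.HodgeConjecture.HodgeConjecture.R90.S8

end
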